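import Summits.ResolutionOfSingularities.ResolutionOfSingularities.Theorems.FrobeniusClosingPatchingRelPerfectRoofEngineNonClosedStep
import Summits.ResolutionOfSingularities.ResolutionOfSingularities.Theorems.FrobeniusLadderFInjectiveMacaulayficationAdmissibleLocalCentre
import HarnessLib

/-!
# THEOREM A-adm: the d-UNIFORM induction in TEMKIN'S (iii) FORM with X_reg-ADMISSIBLE local blow-ups only — desingularization OFF THE CLOSED POINTS
# (crux `FInjectiveMacaulayfication` stmt-ResolutionOfSingularities-15315, chain w45a; res-L1-w45a-plan-1 RULING R17.8 programme «AD» (AD2-1); seat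
# res-L1-w45a-stub-3 g7)

[OURS · L1 W4.5a] Support file (`--supports stmt-ResolutionOfSingularities-15315 --as helper`); NOT a statement of any manuscript; def-free, UNCONDITIONAL;
AI-written (AI review is weaker than expert review). Twin of this seat's `…DesingularizationOffClosedPointsFibre` (p588093) with the local input weakened
ONCE MORE: the hypothesis is only asked for ADMISSIBLE local blow-ups, i.e. blow-ups `g : S′ → Spec 𝒪_{X,ζ}` along centres `I` with
`Supp I ⊆ (Reg Spec 𝒪_{X,ζ})ᶜ` — which is all the induction ever uses: its running centre `J` has `Supp J ⊆ Sing X`, and this transports to the local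
scheme (`AdmissibleLocalCentre.support_comap_fromSpecStalk_subset`). The hypothesis:

  `hloc : ∀ ζ, ¬ IsClosed {ζ} → (∀ S′ g I, IsBlowup g I → Supp I ⊆ (Reg Spec 𝒪_ζ)ᶜ → (∀ s ∉ Reg S′, g s = closedPoint) → S′.AdmitsDesingularization)`
  `        ∨ (∃ x, ζ ⤳ x ∧ ∀ S′ g I, IsBlowup g I → Supp I ⊆ (Reg Spec 𝒪_x)ᶜ → S′.AdmitsDesingularization)`

= [Temkin 2008, Prop. 2.3.4 (iii)]'s category verbatim (X_reg-admissible, fibre-singular) at the maximal point, or unconditional-admissible at a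
specialisation (Cossart–Piltant below local dimension 4). Conclusions as in the twins.
[cite: Temkin2008, Prop. 2.3.4 (iii)⇒(ii) (proof, arXiv p. 12); Lemma 2.1.1; Lemma 2.1.4; Def. 2.2.6] [cite: StacksProject, Tag 080B; Tag 01J7]
-/

-- single-problem summit: the doubled namespace component is forced
set_option linter.dupNamespace false

noncomputable section

namespace Summit.ResolutionOfSingularities.ResolutionOfSingularities.Theorems.FInjectiveMacaulayfication.DesingularizationOffClosedPointsAdm

open CategoryTheory CategoryTheory.Limits AlgebraicGeometry TopologicalSpace IsLocalRing
open Literature.AlgebraicGeometry.Resolution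

universe u

-- adapted from this seat's `…DesingularizationOffClosedPointsFibre` (p588093) ← `…Gen` (p587470) ← res-L1-w45a-lead-1's p582779 ← Literature `temkin2008_prop234_of_comp`
/-- **THEOREM A-adm (induction form, Temkin (iii), admissible centres)**: for `X` integral of finite type over a Noetherian quasi-excellent `k`, if at every
NON-closed point EITHER every ADMISSIBLE FIBRE-SINGULAR local blow-up admits a desingularization OR some specialisation has all its ADMISSIBLE local blow-ups
desingularisable, then some blowing up `X′ → X` along a centre supported in `Sing X` is regular at every point over a non-closed point of `X`.
[folklore; cite: Temkin2008, Prop. 2.3.4 (iii)⇒(ii)] -/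
theorem desingularization_offClosedPoints_of_local_adm
    {k : Scheme.{u}} [IsNoetherian k] (hk : Scheme.IsQuasiExcellent k)
    {X : Scheme.{u}} (f₀ : X ⟶ k) [IsIntegral X] [LocallyOfFiniteType f₀] [QuasiCompact f₀]
    (hloc : ∀ ζ : X, ¬ IsClosed ({ζ} : Set X) →
      (∀ (S' : Scheme.{u}) (g : S' ⟶ Spec (X.presheaf.stalk ζ)) (I : (Spec (X.presheaf.stalk ζ)).IdealSheafData),
        IsBlowup g I → ((I.support : Set _) ⊆ (Scheme.regularLocus (Spec (X.presheaf.stalk ζ)))ᶜ) →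
          (∀ s : S', s ∉ Scheme.regularLocus S' → g.base s = closedPoint (X.presheaf.stalk ζ)) →
          Scheme.AdmitsDesingularization S') ∨
      (∃ x : X, ζ ⤳ x ∧ ∀ (S' : Scheme.{u}) (g : S' ⟶ Spec (X.presheaf.stalk x)) (I : (Spec (X.presheaf.stalk x)).IdealSheafData),
        IsBlowup g I → ((I.support : Set _) ⊆ (Scheme.regularLocus (Spec (X.presheaf.stalk x)))ᶜ) →
          Scheme.AdmitsDesingularization S')) :
    ∃ (X' : Scheme.{u}) (f : X' ⟶ X) (J : X.IdealSheafData), IsBlowup f J ∧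
      (J.support : Set X) ⊆ (Scheme.regularLocus X)ᶜ ∧
      ∀ x' : X', ¬ IsClosed ({f x'} : Set X) → x' ∈ Scheme.regularLocus X' := by
  -- `X` is a Noetherian scheme, its singular locus `T` is closed
  haveI : IsLocallyNoetherian X := LocallyOfFiniteType.isLocallyNoetherian f₀
  haveI : CompactSpace X := QuasiCompact.compactSpace_of_compactSpace f₀
  haveI : IsNoetherian X := {}
  set T : Set X := (Scheme.regularLocus X)ᶜ with hT
  have hTc : IsClosed T := isClosed_compl_regularLocus_of_locallyOfFiniteType f₀ hk
  -- the induction statement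
  suffices H : ∀ C : Closeds X, (C : Set X) ⊆ T →
      (∃ (X' : Scheme.{u}) (f : X' ⟶ X) (J : X.IdealSheafData), IsBlowup f J ∧
        (J.support : Set X) ⊆ T ∧ ∀ x' : X', f x' ∉ C → x' ∈ Scheme.regularLocus X') →
      ∃ (X' : Scheme.{u}) (f : X' ⟶ X) (J : X.IdealSheafData), IsBlowup f J ∧
        (J.support : Set X) ⊆ (Scheme.regularLocus X)ᶜ ∧
        ∀ x' : X', ¬ IsClosed ({f x'} : Set X) → x' ∈ Scheme.regularLocus X' by
    refine H ⟨T, hTc⟩ subset_rfl ⟨X, 𝟙 X, ⊤, isBlowup_id_top X, ?_, fun x' hx' => ?_⟩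
    · simp [Scheme.IdealSheafData.support_top]
    · simpa [hT] using hx'
  intro C
  induction C using WellFoundedLT.induction with
  | ind C ih =>
  intro hCT ⟨X', f, J, hf, hJ, hreg⟩
  -- either `X'` is already regular over every non-closed point …
  by_cases hall : ∀ x' : X', ¬ IsClosed ({f x'} : Set X) → x' ∈ Scheme.regularLocus X'
  · exact ⟨X', f, J, hf, hJ, hall⟩
  -- … or `C` has a non-closed point `c = f x₁`
  push Not at hall
  obtain ⟨x₁, hx₁ncl, hx₁⟩ := hall
  have hx₁C : f x₁ ∈ (C : Set X) := by
    by_contra h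
    exact hx₁ (hreg x₁ h)
  -- a MAXIMAL point `ζ` of `C` above the bad non-closed point `f x₁`; it is non-closed
  obtain ⟨ζ, hζC, hζc, hζmax⟩ := Summit.ResolutionOfSingularities.ResolutionOfSingularities.Theorems.exists_maximal_point_specializes C.isClosed hx₁C
  have hζncl : ¬ IsClosed ({ζ} : Set X) := by
    intro hcl
    have hmem : f x₁ ∈ ({ζ} : Set X) := hcl.closure_eq ▸ hζc.mem_closure
    rw [Set.mem_singleton_iff] at hmem
    exact hx₁ncl (hmem ▸ hcl)
  -- `X'` is Noetherian, of finite type over `k`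
  haveI : IsProper f := hf.isProper
  haveI : IsLocallyNoetherian X' := LocallyOfFiniteType.isLocallyNoetherian f
  haveI : CompactSpace X' := QuasiCompact.compactSpace_of_compactSpace f
  haveI : IsNoetherian X' := {}
  -- the step point `x ∈ C` and a desingularization of the local model `X' ×_X Spec 𝒪_{X,x}`: EITHER `x = ζ` (the local model is regular off its
  -- closed fibre by maximality of `ζ` in `C`, so the fibre-singular clause of (hloc) applies) OR a specialisation `x` of `ζ` from the second clause
  obtain ⟨x, hxC, hdesx⟩ : ∃ x : X, x ∈ (C : Set X) ∧ Scheme.AdmitsDesingularization (pullback f (X.fromSpecStalk x)) := by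
    rcases hloc ζ hζncl with hA | ⟨x, hζx, hB⟩
    · haveI : Flat (X.fromSpecStalk ζ) := flat_fromSpecStalk X ζ
      haveI : IsNoetherian (pullback f (X.fromSpecStalk ζ)) := {}
      refine ⟨ζ, hζC, hA _ (pullback.snd f (X.fromSpecStalk ζ)) (J.comap (X.fromSpecStalk ζ)) (hf.pullback_snd_of_flat _)
        (AdmissibleLocalCentre.support_comap_fromSpecStalk_subset J hJ ζ) fun s hs => ?_⟩
      have h1 : pullback.fst f (X.fromSpecStalk ζ) s ∉ Scheme.regularLocus X' := fun h =>
        hs ((mem_regularLocus_iff_pullback_fst_fromSpecStalk f ζ s).mpr h)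
      have h2 : f (pullback.fst f (X.fromSpecStalk ζ) s) ∈ (C : Set X) := by
        by_contra h
        exact h1 (hreg _ h)
      have h3 : f (pullback.fst f (X.fromSpecStalk ζ) s) ⤳ ζ := by
        have hr := Set.mem_range_self (f := pullback.fst f (X.fromSpecStalk ζ)) s
        rw [range_pullback_fst_fromSpecStalk] at hr
        exact hr
      have h4 : f (pullback.fst f (X.fromSpecStalk ζ) s) = ζ := hζmax _ h2 h3
      have h5 : f (pullback.fst f (X.fromSpecStalk ζ) s) = X.fromSpecStalk ζ (pullback.snd f (X.fromSpecStalk ζ) s) := by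
        rw [← Scheme.Hom.comp_apply, pullback.condition, Scheme.Hom.comp_apply]
      apply (X.fromSpecStalk ζ).isEmbedding.injective
      rw [← h5, h4, Scheme.fromSpecStalk_closedPoint]
    · haveI : Flat (X.fromSpecStalk x) := flat_fromSpecStalk X x
      haveI : IsNoetherian (pullback f (X.fromSpecStalk x)) := {}
      exact ⟨x, hζx.mem_closed C.isClosed hζC,
        hB _ (pullback.snd f (X.fromSpecStalk x)) (J.comap (X.fromSpecStalk x)) (hf.pullback_snd_of_flat _)
          (AdmissibleLocalCentre.support_comap_fromSpecStalk_subset J hJ x)⟩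
  -- the local scheme `S = Spec 𝒪_{X,ζ}` and the pro-open pro-subscheme `S' = X' ×_X S` of `X'`
  haveI : Flat (X.fromSpecStalk x) := flat_fromSpecStalk X x
  haveI : IsNoetherian (pullback f (X.fromSpecStalk x)) := {}
  have hgb : IsBlowup (pullback.snd f (X.fromSpecStalk x)) (J.comap (X.fromSpecStalk x)) :=
    hf.pullback_snd_of_flat (X.fromSpecStalk x)
  have hfj : ∀ s : ↑(pullback f (X.fromSpecStalk x)),
      f (pullback.fst f (X.fromSpecStalk x) s) =
        X.fromSpecStalk x (pullback.snd f (X.fromSpecStalk x) s) := fun s => by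
    rw [← Scheme.Hom.comp_apply, pullback.condition, Scheme.Hom.comp_apply]
  -- a singular point of `S'` is singular in `X'`, hence lies over `C`
  have hsingC : ∀ s : ↑(pullback f (X.fromSpecStalk x)),
      s ∉ Scheme.regularLocus (pullback f (X.fromSpecStalk x)) →
        f (pullback.fst f (X.fromSpecStalk x) s) ∈ (C : Set X) := by
    intro s hs
    have h1 : pullback.fst f (X.fromSpecStalk x) s ∉ Scheme.regularLocus X' := fun h =>
      hs ((mem_regularLocus_iff_pullback_fst_fromSpecStalk f x s).mpr h)
    by_contra h
    exact h1 (hreg _ h)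
  -- the local desingularization of ALL of `S'`
  obtain ⟨S'', g', hdes⟩ := hdesx
  obtain ⟨I', hg', hI'⟩ := hdes.exists_isBlowup
  have hS''reg := hdes.isRegular
  -- extend its centre to `X'` (Temkin Lemma 2.1.1) and blow `X'` up along the extension
  obtain ⟨J', hJ'I', hJ'supp⟩ := exists_idealSheaf_extension_fromSpecStalk f x I'
  obtain ⟨X'', f', hf'⟩ := exists_isBlowup X' J'
  -- the new centre lies over `C ⊆ T`
  have hIC : ∀ s ∈ (I'.support : Set ↑(pullback f (X.fromSpecStalk x))),
      f (pullback.fst f (X.fromSpecStalk x) s) ∈ (C : Set X) := fun s hs => hsingC s (hI' hs)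
  have hJ'C : f '' (J'.support : Set X') ⊆ (C : Set X) := by
    rw [hJ'supp]
    refine (image_closure_subset_closure_image f.continuous).trans ?_
    refine C.isClosed.closure_subset_iff.mpr ?_
    rintro _ ⟨_, ⟨s, hs, rfl⟩, rfl⟩
    exact hIC s hs
  have hJ'T : (J'.support : Set X') ⊆ f ⁻¹' T := fun x' hx' => hCT (hJ'C ⟨x', hx', rfl⟩)
  -- so the composite is a `T`-supported blow-up of `X` (Temkin Lemma 2.1.4 = Stacks 080B)
  obtain ⟨J₂, hf₂, hJ₂⟩ := hf.exists_isBlowup_comp_supported f J f' J' T hJ hf' hJ'T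
  -- `X''` is of finite type over `k`: its singular locus is closed, with closed image `C'`
  haveI : IsProper f' := hf'.isProper
  have hreg'' : IsClosed (Scheme.regularLocus X'')ᶜ :=
    isClosed_compl_regularLocus_of_locallyOfFiniteType ((f' ≫ f) ≫ f₀) hk
  let C' : Closeds X :=
    ⟨(f' ≫ f) '' (Scheme.regularLocus X'')ᶜ, (f' ≫ f).isClosedMap _ hreg''⟩
  -- `C' ⊆ C ∖ {ζ}`
  have hC'C : (C' : Set X) ⊆ (C : Set X) \ {x} := by
    rintro _ ⟨x'', hx'', rfl⟩
    refine ⟨?_, ?_⟩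
    · -- over `X ∖ C`: `X'` is regular there and `f'` is an isomorphism off its centre
      by_contra hy
      have hy' : f (f' x'') ∉ (C : Set X) := by rwa [Scheme.Hom.comp_apply] at hy
      have h1 : f' x'' ∈ Scheme.regularLocus X' := hreg _ hy'
      have h2 : f' x'' ∉ (J'.support : Set X') := fun h => hy' (hJ'C ⟨_, h, rfl⟩)
      haveI := hf'.isIso_compl
      exact hx'' ((mem_regularLocus_iff_of_isIso_morphismRestrict f'
        ⟨(J'.support : Set X')ᶜ, J'.support.isClosed.isOpen_compl⟩ x'' h2).mpr h1)
    · -- over `ζ`: `X'' ×_{X'} S'` is the regular scheme `S''` (flat base change, uniqueness)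
      intro hyx
      rw [Set.mem_singleton_iff, Scheme.Hom.comp_apply] at hyx
      obtain ⟨s, hs⟩ := mem_range_pullback_fst_fromSpecStalk_of_eq f x hyx
      have hT' : IsBlowup (pullback.snd f' (pullback.fst f (X.fromSpecStalk x))) I' := by
        rw [← hJ'I']
        exact hf'.pullback_snd_of_flat _
      obtain ⟨e, -, -⟩ := hT'.unique hg'
      have hx''range : x'' ∈ Set.range (pullback.fst f' (pullback.fst f (X.fromSpecStalk x))) := by
        rw [Scheme.Pullback.range_fst]
        exact ⟨s, hs⟩
      obtain ⟨t, rfl⟩ := hx''range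
      apply hx''
      refine (mem_regularLocus_iff_of_flat_of_isPreimmersion _ t).mp ?_
      exact (mem_regularLocus_iff_of_flat_of_isPreimmersion e.hom t).mpr (hS''reg _)
  have hlt : C' < C := by
    refine lt_of_le_of_ne (fun y hy => (hC'C hy).1) fun h => ?_
    have hx' : x ∈ (C' : Set X) := by
      rw [h]
      exact hxC
    exact (hC'C hx').2 rfl
  exact ih C' hlt (fun y hy => hCT (hC'C hy).1)
    ⟨X'', f' ≫ f, J₂, hf₂, hJ₂, fun x'' hx'' => by
      by_contra h
      exact hx'' ⟨x'', h, rfl⟩⟩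

/-- **THEOREM A-adm, finite-residual reading**: regular off the preimage of a FINITE set of CLOSED points. [folklore; cite: Temkin2008, Prop. 2.3.4] -/
theorem desingularization_offFinite_of_local_adm
    {k : Scheme.{u}} [IsNoetherian k] (hk : Scheme.IsQuasiExcellent k)
    {X : Scheme.{u}} (f₀ : X ⟶ k) [IsIntegral X] [LocallyOfFiniteType f₀] [QuasiCompact f₀]
    (hloc : ∀ ζ : X, ¬ IsClosed ({ζ} : Set X) →
      (∀ (S' : Scheme.{u}) (g : S' ⟶ Spec (X.presheaf.stalk ζ)) (I : (Spec (X.presheaf.stalk ζ)).IdealSheafData),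
        IsBlowup g I → ((I.support : Set _) ⊆ (Scheme.regularLocus (Spec (X.presheaf.stalk ζ)))ᶜ) →
          (∀ s : S', s ∉ Scheme.regularLocus S' → g.base s = closedPoint (X.presheaf.stalk ζ)) →
          Scheme.AdmitsDesingularization S') ∨
      (∃ x : X, ζ ⤳ x ∧ ∀ (S' : Scheme.{u}) (g : S' ⟶ Spec (X.presheaf.stalk x)) (I : (Spec (X.presheaf.stalk x)).IdealSheafData),
        IsBlowup g I → ((I.support : Set _) ⊆ (Scheme.regularLocus (Spec (X.presheaf.stalk x)))ᶜ) →
          Scheme.AdmitsDesingularization S')) :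
    ∃ (X' : Scheme.{u}) (f : X' ⟶ X) (J : X.IdealSheafData) (F : Set X), IsBlowup f J ∧
      (J.support : Set X) ⊆ (Scheme.regularLocus X)ᶜ ∧ IsClosed F ∧ F.Finite ∧ (∀ b ∈ F, IsClosed ({b} : Set X)) ∧
      ∀ x' : X', f x' ∉ F → x' ∈ Scheme.regularLocus X' := by
  haveI : IsLocallyNoetherian X := LocallyOfFiniteType.isLocallyNoetherian f₀
  haveI : CompactSpace X := QuasiCompact.compactSpace_of_compactSpace f₀
  haveI : IsNoetherian X := {}
  obtain ⟨X', f, J, hf, hJ, hreg⟩ := desingularization_offClosedPoints_of_local_adm hk f₀ hloc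
  haveI : IsProper f := hf.isProper
  have hreg' : IsClosed (Scheme.regularLocus X')ᶜ :=
    isClosed_compl_regularLocus_of_locallyOfFiniteType (f ≫ f₀) hk
  have hFc : IsClosed (f '' (Scheme.regularLocus X')ᶜ) := f.isClosedMap _ hreg'
  have hFpts : ∀ b ∈ f '' (Scheme.regularLocus X')ᶜ, IsClosed ({b} : Set X) := by
    rintro _ ⟨x', hx', rfl⟩
    by_contra h
    exact hx' (hreg x' h)
  refine ⟨X', f, J, f '' (Scheme.regularLocus X')ᶜ, hf, hJ, hFc, ?_, hFpts, fun x' hx' => ?_⟩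
  · -- a closed set of closed points of a Noetherian sober space is finite
    obtain ⟨S, hSf, hSc, hSi, hS⟩ := NoetherianSpace.exists_finite_set_isClosed_irreducible hFc
    rw [hS]
    refine hSf.sUnion fun t ht => ?_
    obtain ⟨z, hz⟩ := QuasiSober.sober (hSi t ht) (hSc t ht)
    have hzF : z ∈ f '' (Scheme.regularLocus X')ᶜ := by
      rw [hS]
      exact Set.subset_sUnion_of_mem ht hz.mem
    have ht' : t = {z} := by
      rw [← hz.def, (hFpts z hzF).closure_eq]
    rw [ht']
    exact Set.finite_singleton z
  · by_contra h
    exact hx' ⟨x', h, rfl⟩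

end Summit.ResolutionOfSingularities.ResolutionOfSingularities.Theorems.FInjectiveMacaulayfication.DesingularizationOffClosedPointsAdm

end
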